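import Mathlib.NumberTheory.ArithmeticFunction.Moebius
import Summits.RiemannHypothesis.RiemannHypothesis.Theorems.NymanBeurlingMinimiserCriterion
import HarnessLib

/-!
# Splittings / NB — census row V38 «LIMIT COEFFICIENTS» (file 1 of 3, RH-FREE): the plateau engine and the two LOCKS —
minimality of the dilation system `ρ_{k+1}(x) = {1/((k+1)x)}` in `L²(0,∞)` uniformly in the length `N`, and the Möbius lock

Cell rh-split, seat rh-split-nb-neg g13 (card `SPLIT-nb-neg.md` §19).  The three files `NbLimitCoefficients`,
`NbLimitCoefficientsConvergence`, `NbLimitCoefficientsRigidity` decide the census row V12/S6 — the index split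
FIN(K) «lim_N c⋆_{N,j} = −μ(j+1) for j < K» ∧ TAIL(K) «… for j ≥ K» of the Weingartner-type COEFFICIENT LAW — in the route's
own `L²(0,∞)` setting, on the LANDED minimiser `c⋆_N = nbMinimiser N = G_N⁻¹ b` of `Theorems/NymanBeurlingMinimiser.lean`
(`d_N² = nbDistSq N (nbMinimiser N)`, `RH ↔ d_N² → 0` = `riemannHypothesis_iff_tendsto_nbDistSq_nbMinimiser`).

This file (all Lebesgue integrals over `(0,∞)`; `D_c(m) := Σ_k c_k ⌊m/(k+1)⌋`, `τ(c) := tailConst c = Σ_k c_k/(k+1)`):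
* §1 padding a vector with zeros (`sum_pad_mul`, `approx_pad`, `nbDistSq_pad`, `tailConst_pad`);
* §2 `sq_add_sumFloor_le` — the CELL BOUND: on the Farey cell `I_{n+1} = (1/(n+2), 1/(n+1)]` the function `e − Σ_k c_k ρ_{k+1}`
  equals `(e + D_c(n+1)) − τ(c)/x`, whence `(e + D_c(n+1))² ≤ 2(n+2)²·(∫_{(0,1]} (e − Σ c_k ρ_{k+1})² + τ(c)²)`; readings
  `abs_one_add_sumFloor_le` (`|1 + D_c(n+1)| ≤ (n+2)√(2 d_N²(c))`) and `abs_sumFloor_le` (`|D_u(n+1)| ≤ (n+2)√(2 u·G_N u)`);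
* §3 `sum_ite_dvd_moebius`, `sum_moebius_mul_floor` — `Σ_{(k+1)∣(m+1)} μ(k+1) = [m = 0]`, `Σ_{k<N} μ(k+1)⌊(m+1)/(k+1)⌋ = 1`;
* §4 `abs_le_of_abs_sumDvd_le` — TRIANGULAR INVERSION WITH ERRORS: `|Σ_{(k+1)∣(m+1)} u_k| ≤ (2m+3) r` (`m < N`) forces
  `|u_j| ≤ 5·2^j·r`;
* §5 `abs_apply_le_of_gram` — MINIMALITY, UNIFORMLY IN `N`: `|u_j| ≤ 5·2^j √(2 u·G_N u)` for every `u : Fin N → ℝ`;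
  `abs_add_moebius_le` — the MÖBIUS LOCK: `|c_j + μ(j+1)| ≤ 5·2^j √(2 d_N²(c))` for EVERY `c : Fin N → ℝ`.
(The `j`-dependence `5·2^j` is crude — `6σ₁(j+1)` holds, cf. card §18 — but irrelevant for limits at fixed `j`.)

No `def`s; RH-free; standard axioms.  HONEST LABEL: «SPLITTING SEARCH over kernel-typed RH-EQUIVALENCES; a splitting
A ∧ B ⟹ RH is CONDITIONAL bookkeeping unless A and B are both proved; nothing here bears on the truth of RH.»
-/

set_option linter.dupNamespace false

noncomputable section

open MeasureTheory Set Finset Filter Topology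
open scoped Matrix

namespace Summit.RiemannHypothesis.RiemannHypothesis.Theorems.Splittings.NbLimitCoefficients

open Literature.NumberTheory.LFunctions Literature.NumberTheory.LFunctions.BaezDuarteOnlyIf
open Summit.RiemannHypothesis.RiemannHypothesis.Theorems.NbTheory
open Summit.RiemannHypothesis.RiemannHypothesis.Theorems.NbTheory.GramPosDef
open Summit.RiemannHypothesis.RiemannHypothesis.Theorems.NbTheory.Minimiser
open Summit.RiemannHypothesis.RiemannHypothesis.Theorems.NbTheory.Criterion
open ArithmeticFunction (moebius)


/-! ## §1 Padding a coefficient vector with zeros -/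

/-- Summing a zero-padded vector against any weight is summing the original vector. -/
theorem sum_pad_mul {M N : ℕ} (c : Fin M → ℝ) (hMN : M ≤ N) (f : ℕ → ℝ) :
    ∑ k : Fin N, (if h : (k : ℕ) < M then c ⟨k, h⟩ else 0) * f k = ∑ k : Fin M, c k * f k := by
  have hL := Fin.sum_univ_eq_sum_range (fun i ↦ (if h : i < M then c ⟨i, h⟩ else 0) * f i) N
  have hR := Fin.sum_univ_eq_sum_range (fun i ↦ (if h : i < M then c ⟨i, h⟩ else 0) * f i) M
  have hR' : ∑ k : Fin M, c k * f k = ∑ i ∈ range M, (if h : i < M then c ⟨i, h⟩ else 0) * f i := by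
    rw [← hR]
    refine Finset.sum_congr rfl fun k _ ↦ ?_
    rw [dif_pos k.isLt]
  rw [hL, hR']
  symm
  refine Finset.sum_subset (Finset.range_mono hMN) fun i _ hi ↦ ?_
  rw [Finset.mem_range, not_lt] at hi
  rw [dif_neg (by omega), zero_mul]

/-- Padding does not change the approximant `χ − Σ c_k ρ_{k+1}` … -/
theorem approx_pad {M N : ℕ} (c : Fin M → ℝ) (hMN : M ≤ N) :
    approx (fun k : Fin N ↦ if h : (k : ℕ) < M then c ⟨k, h⟩ else 0) = approx c := by
  funext x
  unfold approx
  congr 1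
  exact sum_pad_mul c hMN fun i ↦ Int.fract (1 / (((i : ℝ) + 1) * x))

/-- … nor the squared distance `d²`. -/
theorem nbDistSq_pad {M N : ℕ} (c : Fin M → ℝ) (hMN : M ≤ N) :
    nbDistSq N (fun k : Fin N ↦ if h : (k : ℕ) < M then c ⟨k, h⟩ else 0) = nbDistSq M c := by
  rw [nbDistSq_eq_integral, nbDistSq_eq_integral, approx_pad c hMN]

/-- … nor the tail constant `τ(c) = Σ c_k/(k+1)`. -/
theorem tailConst_pad {M N : ℕ} (c : Fin M → ℝ) (hMN : M ≤ N) :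
    tailConst (fun k : Fin N ↦ if h : (k : ℕ) < M then c ⟨k, h⟩ else 0) = tailConst c := by
  unfold tailConst
  simp_rw [div_eq_mul_inv]
  exact sum_pad_mul c hMN fun i ↦ ((i : ℝ) + 1)⁻¹

/-- … nor the competitor `Σ c_k ρ_{k+1}` pointwise. -/
theorem sum_pad_mul_nbRho {M N : ℕ} (c : Fin M → ℝ) (hMN : M ≤ N) (x : ℝ) :
    ∑ k : Fin N, (if h : (k : ℕ) < M then c ⟨k, h⟩ else 0) * nbRho k x = ∑ k : Fin M, c k * nbRho k x :=
  sum_pad_mul c hMN fun i ↦ nbRho i x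

/-! ## §2 The cell bound -/

/-- `χ − Σ c_k ρ_{k+1}` written out (definitional). -/
theorem approx_eq {N : ℕ} (c : Fin N → ℝ) (x : ℝ) :
    approx c x = (Set.Ioc (0 : ℝ) 1).indicator 1 x - ∑ k : Fin N, c k * nbRho k x := rfl

/-- **CELL BOUND (RH-FREE).** For every `c`, `e` and cell index `n`:
`(e + D_c(n+1))² ≤ (n+2)²·2·(∫_{(0,1]} (e − Σ c_k ρ_{k+1})² + τ(c)²)` — on `I_{n+1}` the integrand is the square of
`(e + D_c(n+1)) − τ/x` with `1/x < n+2`, and `|I_{n+1}| = 1/((n+1)(n+2))`. -/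
theorem sq_add_sumFloor_le {N : ℕ} (c : Fin N → ℝ) (e : ℝ) (n : ℕ) :
    (e + ∑ k : Fin N, c k * (((n + 1) / ((k : ℕ) + 1) : ℕ) : ℝ)) ^ 2 ≤
      ((n : ℝ) + 2) ^ 2 * (2 * ((∫ x in Set.Ioc (0 : ℝ) 1, (e - ∑ k : Fin N, c k * nbRho k x) ^ 2) +
        tailConst c ^ 2)) := by
  set D : ℝ := ∑ k : Fin N, c k * (((n + 1) / ((k : ℕ) + 1) : ℕ) : ℝ) with hD
  set T : ℝ := tailConst c with hT
  set H : ℝ := ∫ x in Set.Ioc (0 : ℝ) 1, (e - ∑ k : Fin N, c k * nbRho k x) ^ 2 with hH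
  have hHnn : 0 ≤ H := integral_nonneg fun x ↦ sq_nonneg _
  have hFi := integrableOn_sq_const_sub c e
  -- pointwise on the cell
  have hpt : ∀ x ∈ nbI n, (e + D) ^ 2 ≤
      2 * (e - ∑ k : Fin N, c k * nbRho k x) ^ 2 + 2 * T ^ 2 * ((n : ℝ) + 2) ^ 2 := by
    intro x hx
    have hx0 : 0 < x := pos_of_mem_nbI hx
    have hcell : e - ∑ k : Fin N, c k * nbRho k x = (e + D) - T / x := by
      rw [sum_mul_nbRho_eq_of_mem_nbI c hx]; ring
    have hinv : 1 / x < (n : ℝ) + 2 := (one_div_lt hx0 (by positivity)).2 hx.1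
    have hinv0 : 0 < 1 / x := by positivity
    have h1 : (T / x) ^ 2 ≤ T ^ 2 * ((n : ℝ) + 2) ^ 2 := by
      rw [div_eq_mul_one_div, mul_pow]
      exact mul_le_mul_of_nonneg_left (pow_le_pow_left₀ hinv0.le hinv.le 2) (sq_nonneg _)
    have h2 : (e + D) ^ 2 ≤ 2 * ((e + D) - T / x) ^ 2 + 2 * (T / x) ^ 2 := by
      nlinarith [sq_nonneg ((e + D) - T / x - T / x)]
    rw [hcell]
    linarith
  -- integrate over the cell
  have hvol := volume_real_nbI n
  have hvpos := volume_real_nbI_pos n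
  have hIcell : IntegrableOn (fun x ↦ (e - ∑ k : Fin N, c k * nbRho k x) ^ 2) (nbI n) := hFi.mono_set (nbI_subset n)
  have hfin : volume (nbI n) < ⊤ := measure_Ioc_lt_top
  have hconst : IntegrableOn (fun _ : ℝ ↦ 2 * T ^ 2 * ((n : ℝ) + 2) ^ 2) (nbI n) :=
    integrableOn_const (hs := hfin.ne)
  have hconst' : IntegrableOn (fun _ : ℝ ↦ (e + D) ^ 2) (nbI n) := integrableOn_const (hs := hfin.ne)
  have hmono : ∫ x in nbI n, (e + D) ^ 2 ≤
      ∫ x in nbI n, (2 * (e - ∑ k : Fin N, c k * nbRho k x) ^ 2 + 2 * T ^ 2 * ((n : ℝ) + 2) ^ 2) :=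
    setIntegral_mono_on hconst' ((hIcell.const_mul 2).add hconst) (measurableSet_nbI n) hpt
  have hle : ∫ x in nbI n, (e - ∑ k : Fin N, c k * nbRho k x) ^ 2 ≤ H :=
    setIntegral_mono_set hFi (ae_of_all _ fun x ↦ sq_nonneg _) (ae_of_all _ (nbI_subset n))
  rw [setIntegral_const, smul_eq_mul, integral_add (hIcell.const_mul 2) hconst, integral_const_mul,
    setIntegral_const, smul_eq_mul] at hmono
  set v := volume.real (nbI n) with hv
  have hv' : v * (((n : ℝ) + 1) * ((n : ℝ) + 2)) = 1 := by
    rw [hvol]; field_simp; ring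
  have hmain : v * (e + D) ^ 2 ≤ 2 * H + v * (2 * T ^ 2 * ((n : ℝ) + 2) ^ 2) := by linarith
  have hn0 : (0 : ℝ) ≤ n := n.cast_nonneg
  calc (e + D) ^ 2 = v * (e + D) ^ 2 * (((n : ℝ) + 1) * ((n : ℝ) + 2)) := by
        rw [mul_comm v, mul_assoc, hv', mul_one]
    _ ≤ (2 * H + v * (2 * T ^ 2 * ((n : ℝ) + 2) ^ 2)) * (((n : ℝ) + 1) * ((n : ℝ) + 2)) :=
        mul_le_mul_of_nonneg_right hmain (by positivity)
    _ = 2 * H * (((n : ℝ) + 1) * ((n : ℝ) + 2)) +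
          2 * T ^ 2 * ((n : ℝ) + 2) ^ 2 * (v * (((n : ℝ) + 1) * ((n : ℝ) + 2))) := by ring
    _ = 2 * H * (((n : ℝ) + 1) * ((n : ℝ) + 2)) + 2 * T ^ 2 * ((n : ℝ) + 2) ^ 2 := by rw [hv', mul_one]
    _ ≤ ((n : ℝ) + 2) ^ 2 * (2 * (H + T ^ 2)) := by nlinarith [sq_nonneg T]

/-- `e = 1`: **`|1 + D_c(n+1)| ≤ (n+2)·√(2 d_N²(c))`** for every coefficient vector `c` (head + tail = `d²`). -/
theorem abs_one_add_sumFloor_le {N : ℕ} (c : Fin N → ℝ) (n : ℕ) :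
    |1 + ∑ k : Fin N, c k * (((n + 1) / ((k : ℕ) + 1) : ℕ) : ℝ)| ≤ ((n : ℝ) + 2) * Real.sqrt (2 * nbDistSq N c) := by
  have h := sq_add_sumFloor_le c 1 n
  rw [← nbDistSq_eq_head_add_tail] at h
  have hd : 0 ≤ 2 * nbDistSq N c := by have := nbDistSq_pos c; positivity
  refine abs_le_of_sq_le_sq ?_ (by positivity)
  rw [mul_pow, Real.sq_sqrt hd]
  exact h

/-- `e = 0`: **`|D_u(n+1)| ≤ (n+2)·√(2 u·G_N u)`** for every vector `u` (the Gram form is `∫_{(0,1]} (Σ u_k ρ_{k+1})² + τ(u)²`). -/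
theorem abs_sumFloor_le {N : ℕ} (u : Fin N → ℝ) (n : ℕ) :
    |∑ k : Fin N, u k * (((n + 1) / ((k : ℕ) + 1) : ℕ) : ℝ)| ≤
      ((n : ℝ) + 2) * Real.sqrt (2 * (u ⬝ᵥ (nbGramMatrix N *ᵥ u))) := by
  have h := sq_add_sumFloor_le u 0 n
  have h0 : (∫ x in Set.Ioc (0 : ℝ) 1, (0 - ∑ k : Fin N, u k * nbRho k x) ^ 2) =
      ∫ x in Set.Ioc (0 : ℝ) 1, (∑ k : Fin N, u k * nbRho k x) ^ 2 := by
    simp only [zero_sub, even_two.neg_pow]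
  rw [zero_add, h0, ← dotProduct_nbGram0Matrix_mulVec, ← dotProduct_nbGramMatrix_mulVec] at h
  have hQ : 0 ≤ u ⬝ᵥ (nbGramMatrix N *ᵥ u) := by
    have := (nbGramMatrix_posDef N).posSemidef.dotProduct_mulVec_nonneg u
    rwa [star_trivial] at this
  refine abs_le_of_sq_le_sq ?_ (by positivity)
  rw [mul_pow, Real.sq_sqrt (by positivity)]
  exact h

/-! ## §3 Möbius bookkeeping: `Σ_{(k+1) ∣ (m+1)} μ(k+1) = [m = 0]` and `Σ_k μ(k+1)⌊(m+1)/(k+1)⌋ = 1` -/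

/-- `Σ_{k<N, (k+1)∣(m+1)} μ(k+1) = Σ_{d ∣ m+1} μ(d) = [m = 0]` for `m < N`. -/
theorem sum_ite_dvd_moebius {N m : ℕ} (hm : m < N) :
    ∑ k : Fin N, (if (k : ℕ) + 1 ∣ m + 1 then (moebius ((k : ℕ) + 1) : ℝ) else 0) = if m = 0 then 1 else 0 := by
  have hμ : ∑ d ∈ (m + 1).divisors, (moebius d : ℝ) = if m + 1 = 1 then 1 else 0 := by
    have h := congrArg (fun f : ArithmeticFunction ℝ ↦ f (m + 1))
      (ArithmeticFunction.coe_moebius_mul_coe_zeta (R := ℝ))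
    simp only [ArithmeticFunction.coe_mul_zeta_apply, ArithmeticFunction.intCoe_apply,
      ArithmeticFunction.one_apply] at h
    exact h
  have hL := Fin.sum_univ_eq_sum_range (fun i ↦ if i + 1 ∣ m + 1 then (moebius (i + 1) : ℝ) else 0) N
  rw [hL]
  have hshift : ∑ i ∈ range N, (if i + 1 ∣ m + 1 then (moebius (i + 1) : ℝ) else 0) =
      ∑ d ∈ Finset.Ico 1 (N + 1), (if d ∣ m + 1 then (moebius d : ℝ) else 0) := by
    rw [Finset.sum_Ico_eq_sum_range]
    simp only [Nat.add_sub_cancel, add_comm 1]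
  rw [hshift, ← Finset.sum_filter]
  have hset : (Finset.Ico 1 (N + 1)).filter (fun d ↦ d ∣ m + 1) = (m + 1).divisors := by
    ext d
    simp only [Finset.mem_filter, Finset.mem_Ico, Nat.mem_divisors]
    constructor
    · rintro ⟨⟨h1, h2⟩, h3⟩; exact ⟨h3, by omega⟩
    · rintro ⟨h3, -⟩
      have := Nat.le_of_dvd (Nat.succ_pos m) h3
      have h0 : 0 < d := Nat.pos_of_dvd_of_pos h3 (Nat.succ_pos m)
      exact ⟨⟨h0, by omega⟩, h3⟩
  rw [hset, hμ]
  simp only [Nat.add_eq_right]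

/-- `Σ_{k<N} μ(k+1)·⌊(m+1)/(k+1)⌋ = 1` for `m < N` (telescoping the previous lemma). -/
theorem sum_moebius_mul_floor {N : ℕ} : ∀ {m : ℕ}, m < N →
    ∑ k : Fin N, (moebius ((k : ℕ) + 1) : ℝ) * (((m + 1) / ((k : ℕ) + 1) : ℕ) : ℝ) = 1
  | 0, h0 => by
    have h := sum_floor_succ_sub (fun k : Fin N ↦ (moebius ((k : ℕ) + 1) : ℝ)) 0
    rw [sum_floor_zero, sub_zero, sum_ite_dvd_moebius h0] at h
    simpa using h
  | m + 1, hm => by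
    have ih := sum_moebius_mul_floor (N := N) (m := m) (by omega)
    have h := sum_floor_succ_sub (fun k : Fin N ↦ (moebius ((k : ℕ) + 1) : ℝ)) (m + 1)
    rw [ih, sum_ite_dvd_moebius hm, if_neg (Nat.succ_ne_zero m)] at h
    linarith

/-! ## §4 Triangular inversion with errors -/

/-- **INVERSION (pure bookkeeping).**  If `|Σ_{(k+1) ∣ (m+1)} u_k| ≤ (2m+3)·r` for every `m < N`, then
`|u_j| ≤ 5·2^j·r` for every `j < N` (the system is unit lower-triangular in the divisibility order; induct on
`S_n = Σ_{k<n} |u_k| ≤ (5·2^n − 2n − 5)·r`). -/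
theorem abs_le_of_abs_sumDvd_le {N : ℕ} (u : Fin N → ℝ) {r : ℝ} (hr : 0 ≤ r)
    (hJ : ∀ m < N, |∑ k : Fin N, (if (k : ℕ) + 1 ∣ m + 1 then u k else 0)| ≤ (2 * m + 3) * r) (j : Fin N) :
    |u j| ≤ 5 * 2 ^ (j : ℕ) * r := by
  -- `S n = Σ_{k<n} |u_k|`, `X n = |u_n|` (or `0` if `n ≥ N`)
  set S : ℕ → ℝ := fun n ↦ ∑ k : Fin N, (if (k : ℕ) < n then |u k| else 0) with hS
  have hSnn : ∀ n, 0 ≤ S n := fun n ↦ Finset.sum_nonneg fun k _ ↦ by split_ifs <;> simp [abs_nonneg]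
  have hX : ∀ n, ∑ k : Fin N, (if (k : ℕ) = n then |u k| else 0) ≤ (2 * n + 3) * r + S n := by
    intro n
    by_cases hn : n < N
    · set kn : Fin N := ⟨n, hn⟩ with hkn
      have hXeq : ∑ k : Fin N, (if (k : ℕ) = n then |u k| else 0) = |u kn| := by
        rw [Finset.sum_eq_single kn]
        · simp [hkn]
        · intro k _ hk
          rw [if_neg]
          intro e
          exact hk (Fin.ext (by rw [e, hkn]))
        · simp
      have hdec : ∑ k : Fin N, (if (k : ℕ) + 1 ∣ n + 1 then u k else 0) =
          u kn + ∑ k : Fin N, (if (k : ℕ) + 1 ∣ n + 1 ∧ k ≠ kn then u k else 0) := by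
        have : ∑ k : Fin N, (if (k : ℕ) + 1 ∣ n + 1 then u k else 0) =
            ∑ k : Fin N, ((if k = kn then u k else 0) + (if (k : ℕ) + 1 ∣ n + 1 ∧ k ≠ kn then u k else 0)) := by
          refine Finset.sum_congr rfl fun k _ ↦ ?_
          by_cases hk : k = kn
          · subst hk
            simp [hkn]
          · simp [hk]
        rw [this, Finset.sum_add_distrib, Finset.sum_ite_eq']
        simp
      have hR : |∑ k : Fin N, (if (k : ℕ) + 1 ∣ n + 1 ∧ k ≠ kn then u k else 0)| ≤ S n := by
        refine (Finset.abs_sum_le_sum_abs _ _).trans (Finset.sum_le_sum fun k _ ↦ ?_)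
        by_cases hc : (k : ℕ) + 1 ∣ n + 1 ∧ k ≠ kn
        · have h1 : (k : ℕ) + 1 ≤ n + 1 := Nat.le_of_dvd (Nat.succ_pos n) hc.1
          have h2 : (k : ℕ) ≠ n := fun e ↦ hc.2 (Fin.ext (by rw [e, hkn]))
          have h3 : (k : ℕ) < n := by omega
          rw [if_pos hc, if_pos h3]
        · rw [if_neg hc, abs_zero]
          split_ifs <;> simp [abs_nonneg]
      have hJn := hJ n hn
      rw [hdec] at hJn
      rw [hXeq]
      have := abs_add_le (u kn + ∑ k : Fin N, (if (k : ℕ) + 1 ∣ n + 1 ∧ k ≠ kn then u k else 0))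
        (-(∑ k : Fin N, (if (k : ℕ) + 1 ∣ n + 1 ∧ k ≠ kn then u k else 0)))
      rw [add_neg_cancel_right, abs_neg] at this
      linarith
    · have hXeq : ∑ k : Fin N, (if (k : ℕ) = n then |u k| else 0) = 0 := by
        refine Finset.sum_eq_zero fun k _ ↦ ?_
        rw [if_neg]
        have := k.isLt
        omega
      rw [hXeq]
      nlinarith [hSnn n]
  have hstep : ∀ n, S (n + 1) = S n + ∑ k : Fin N, (if (k : ℕ) = n then |u k| else 0) := by
    intro n
    simp only [hS]
    rw [← Finset.sum_add_distrib]
    refine Finset.sum_congr rfl fun k _ ↦ ?_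
    by_cases h1 : (k : ℕ) < n
    · rw [if_pos (by omega), if_pos h1, if_neg (by omega), add_zero]
    · by_cases h2 : (k : ℕ) = n
      · rw [if_pos (by omega), if_neg h1, if_pos h2, zero_add]
      · rw [if_neg (by omega), if_neg h1, if_neg h2, add_zero]
  have hSle : ∀ n, S n ≤ (5 * 2 ^ n - 2 * n - 5) * r := by
    intro n
    induction n with
    | zero =>
      have : S 0 = 0 := Finset.sum_eq_zero fun k _ ↦ by simp
      rw [this]; norm_num
    | succ n ih =>
      rw [hstep n]
      have h2 : (2 : ℝ) ^ (n + 1) = 2 * 2 ^ n := pow_succ' 2 n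
      have := hX n
      push_cast
      rw [h2]
      linarith
  have hj := hX j
  have hXj : ∑ k : Fin N, (if (k : ℕ) = (j : ℕ) then |u k| else 0) = |u j| := by
    rw [Finset.sum_eq_single j]
    · simp
    · intro k _ hk
      rw [if_neg (fun e ↦ hk (Fin.ext e))]
    · simp
  rw [hXj] at hj
  have h2j : (1 : ℝ) ≤ 2 ^ (j : ℕ) := one_le_pow₀ (by norm_num)
  nlinarith [hSle j, h2j]

/-! ## §5 The two locks: minimality of the dilation system (uniformly in `N`), and the Möbius lock -/

/-- `|Σ_{(k+1)∣(m+1)} u_k| ≤ (2m+3)·√(2 u·G_N u)` (`m < N`): the divisor sum is `D_u(m+1) − D_u(m)`. -/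
theorem abs_sumDvd_le_of_gram {N : ℕ} (u : Fin N → ℝ) {m : ℕ} (hm : m < N) :
    |∑ k : Fin N, (if (k : ℕ) + 1 ∣ m + 1 then u k else 0)| ≤
      (2 * m + 3) * Real.sqrt (2 * (u ⬝ᵥ (nbGramMatrix N *ᵥ u))) := by
  have hs : 0 ≤ Real.sqrt (2 * (u ⬝ᵥ (nbGramMatrix N *ᵥ u))) := Real.sqrt_nonneg _
  rw [← sum_floor_succ_sub u m]
  cases m with
  | zero =>
    rw [sum_floor_zero, sub_zero]
    have h := abs_sumFloor_le u 0
    push_cast at h ⊢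
    nlinarith
  | succ m =>
    have h1 := abs_sumFloor_le u (m + 1)
    have h2 := abs_sumFloor_le u m
    push_cast at h1 h2 ⊢
    have := abs_sub (∑ k : Fin N, u k * (((m + 1 + 1) / ((k : ℕ) + 1) : ℕ) : ℝ))
      (∑ k : Fin N, u k * (((m + 1) / ((k : ℕ) + 1) : ℕ) : ℝ))
    nlinarith

/-- `|Σ_{(k+1)∣(m+1)} (c_k + μ(k+1))| ≤ (2m+3)·√(2 d_N²(c))` (`m < N`): the divisor sum is `(1 + D_c(m+1)) − (1 + D_c(m))`
(`m ≥ 1`) resp. `1 + D_c(1)` (`m = 0`), by `Σ_{d∣m+1} μ(d) = [m = 0]`. -/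
theorem abs_sumDvd_le_of_dist {N : ℕ} (c : Fin N → ℝ) {m : ℕ} (hm : m < N) :
    |∑ k : Fin N, (if (k : ℕ) + 1 ∣ m + 1 then c k + (moebius ((k : ℕ) + 1) : ℝ) else 0)| ≤
      (2 * m + 3) * Real.sqrt (2 * nbDistSq N c) := by
  have hs : 0 ≤ Real.sqrt (2 * nbDistSq N c) := Real.sqrt_nonneg _
  have hsplit : ∑ k : Fin N, (if (k : ℕ) + 1 ∣ m + 1 then c k + (moebius ((k : ℕ) + 1) : ℝ) else 0) =
      ∑ k : Fin N, (if (k : ℕ) + 1 ∣ m + 1 then c k else 0) +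
        ∑ k : Fin N, (if (k : ℕ) + 1 ∣ m + 1 then (moebius ((k : ℕ) + 1) : ℝ) else 0) := by
    rw [← Finset.sum_add_distrib]
    refine Finset.sum_congr rfl fun k _ ↦ ?_
    split_ifs <;> simp
  rw [hsplit, sum_ite_dvd_moebius hm, ← sum_floor_succ_sub c m]
  cases m with
  | zero =>
    rw [sum_floor_zero, sub_zero, if_pos rfl, add_comm]
    have h := abs_one_add_sumFloor_le c 0
    push_cast at h ⊢
    nlinarith
  | succ m =>
    rw [if_neg (Nat.succ_ne_zero m), add_zero]
    have h1 := abs_one_add_sumFloor_le c (m + 1)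
    have h2 := abs_one_add_sumFloor_le c m
    push_cast at h1 h2 ⊢
    have := abs_sub (1 + ∑ k : Fin N, c k * (((m + 1 + 1) / ((k : ℕ) + 1) : ℕ) : ℝ))
      (1 + ∑ k : Fin N, c k * (((m + 1) / ((k : ℕ) + 1) : ℕ) : ℝ))
    rw [add_sub_add_left_eq_sub] at this
    nlinarith

/-- **MINIMALITY of the dilation system, uniformly in `N` (RH-FREE).**  For every `N`, every `u : Fin N → ℝ` and every
`j < N`: `|u_j| ≤ 5·2^j·√(2 u·G_N u)` — the `j`-th coordinate is controlled by the `L²(0,∞)` norm of `Σ u_k ρ_{k+1}` with a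
constant INDEPENDENT of `N` (equivalently: `ρ_{j+1}` keeps distance `≥ 2^{-j}/(5√2)·‖…‖`-scale from the span of ALL the other
dilates `ρ_{k+1}`, `k ≠ j`, however many are admitted). -/
theorem abs_apply_le_of_gram {N : ℕ} (u : Fin N → ℝ) (j : Fin N) :
    |u j| ≤ 5 * 2 ^ (j : ℕ) * Real.sqrt (2 * (u ⬝ᵥ (nbGramMatrix N *ᵥ u))) :=
  abs_le_of_abs_sumDvd_le u (Real.sqrt_nonneg _) (fun _ hm ↦ abs_sumDvd_le_of_gram u hm) j

/-- **MÖBIUS LOCK (RH-FREE).**  For every `N`, every coefficient vector `c` and every `j < N`: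
`|c_j + μ(j+1)| ≤ 5·2^j·√(2 d_N²(c))` — any vector at small distance has a Möbius head. -/
theorem abs_add_moebius_le {N : ℕ} (c : Fin N → ℝ) (j : Fin N) :
    |c j + (moebius ((j : ℕ) + 1) : ℝ)| ≤ 5 * 2 ^ (j : ℕ) * Real.sqrt (2 * nbDistSq N c) :=
  abs_le_of_abs_sumDvd_le (fun k ↦ c k + (moebius ((k : ℕ) + 1) : ℝ)) (Real.sqrt_nonneg _)
    (fun _ hm ↦ abs_sumDvd_le_of_dist c hm) j

end Summit.RiemannHypothesis.RiemannHypothesis.Theorems.Splittings.NbLimitCoefficients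

end
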